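import Summits.HodgeConjecture.HodgeConjecture.Theorems.H413HolCotFormsOfModel
import Summits.HodgeConjecture.HodgeConjecture.Theorems.H413ThetaDistAtLine
import Summits.HodgeConjecture.HodgeCM.Model.AdelicThetaDistributionSat_1
import Summits.HodgeConjecture.HodgeCM.Model.ArchKTypeOf
import HarnessLib

/-!
# FLOOR-0 P4, seat S4′(i), junction (J-g) model side — THE MODEL'S THETA DISTRIBUTION LANDS IN `holCotForms (archFactorOf F V)`,
# with its `U(V)(𝔸_f)`- and `U(W)`-laws read on the P0 carriers

Cell hodgecm-mathlib (D-0151), FLOOR 0, crux item H413 = stmt-HodgeConjecture-24833; programme P4, line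
`Cruxes/H413/Lines/F0_P4AdmissibleOccursInH1.lean`, stub S4′ `stub_T3a_holThetaRealisationOfRallisAt`.  Author F0P4-p01 (g0) (seat (i));
SEAT-i MEMO v2 §5 (J-g).  `--supports stmt-HodgeConjecture-24833 --as helper`.  DEF-FREE; theorems only; nothing cited as a fact.

For ANY side `S : ThetaAdelicSide V c` whose archimedean component is the model's `archInfOf V` and whose slot-`k` rational subgroup is the regime
model's `Γ` (both `rfl` for ★ `Theorems/H413ThetaDistAtLine.sideAt`), ANY product datum `D : S.ThetaDistDatum hV k`, a finite level `K` with
`sat(K) ≤ S.Gfin`, the analytic inputs of ★ `isHolGerm_dist` (`hLF`, `hd`, `hCR`), a weight function `f` and a `K`-fixed finite test function `Φ_f`: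

* §1 **`dist_mem_cuspCotSat`**: `D.dist f Φ_f ∈ cuspCotSat V hV K` (A-p13's regime-model avatar of `holCotForms`, ★ `Theorems/H413CuspCotComponents`):
  (L)(W) from ★ `dist_mem_weightForms`, (R) from ★ `dist_mem_adelicThetaSpanSat` + ★ `apply_mul_eq_self_of_mem_adelicThetaSpanSat`, (H) from ★ `isHolGerm_dist`;
* §2 **`funLeft_latticeEquiv_dist_mem_holCotForms`**: hence, for `K` OPEN, its transport `(D.dist f Φ_f) ∘ latticeEquiv` lies in the P0 carrier
  `holCotForms (archFactorOf F V)` (A-p17's ★ `funLeft_latticeEquiv_mem_holCotForms`, p791747) — the «values in `holCotForms 𝔞₀`» clause of S4′'s `θ_t`;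
* §3 the two laws of the transported distribution on the P0 side: **`funLeft_latticeEquiv_dist_ωf_V`** — `(dist f (ωf (k_f,1) Φ_f)) ∘ e = rightRep F V k_f
  ((dist f Φ_f) ∘ e)` (★ `dist_ωf_V` + ★ `funLeft_latticeEquiv_rightShift`) = the EQUIVARIANCE clause of `θ_t`; **`funLeft_latticeEquiv_dist_ωf_W`** —
  `(dist (charInv χ) (ωf (1,u) Φ_f)) ∘ e = χ(toIdele u)⁻¹ • ((dist (charInv χ) Φ_f) ∘ e)` (★ `dist_ωf_W`) = the `χ`-covariance by which `θ` DESCENDS to the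
  coinvariants `ω_V(t)` (★ `weilCoinvLift`, ★ `Theorems/H413WeilCoinvTwinBridge.weilCoinvLift_twin`);
* §4 the same at the degenerate seesaw context of ★ `Theorems/H413ThetaDistAtLine`: `sat(K) ≤ (sideAt …).Gfin` is ★ `satLevelRegimeOf_le_archFinOf`, the
  two `rfl`s are `sideAt_ιinf`∕`sideAt_P_ΓU` — `distDatumAt_mem_cuspCotSat`, `funLeft_latticeEquiv_distDatumAt_mem_holCotForms`.

So the model-side half of `HolReal t` is: `θ₀ := (LinearMap.funLeft ℂ _ (latticeEquiv F V hV)) ∘ₗ D.dist (charInv χ̃)` is `ℂ`-linear `FinSB → (Adelic → ℂ²)`, valued in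
`holCotForms (archFactorOf F V)`, `rightRep`-equivariant along `D.ωf (·,1)`, `χ̃⁻¹`-covariant along `D.ωf (1,·)`.  What remains for S4′ is the junction of
`D.ωf = finRepZero …` with the pin's `finPairRepW` (J-a ★, J-b p792671, J-c `ιVE = finFrameCongr` rfl, J-d `finCharZero`), the line transport (LT, A-p17),
the archimedean inputs (`Φarch`∕`harm`∕`hχ`∕`hdef`∕`A`, MEMO v2 §6) and `θ ≠ 0` (seat (ii)).  HC_CM is proved only modulo the printed citations until rung 0 closes.

## References
* [BorelJacquet1979] A. Borel, H. Jacquet, Corvallis PSPM 33.1, §4.1–§4.2.  [BorelWallach2000] A. Borel, N. Wallach, VII 2.10.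
* [Weil1964] A. Weil, Acta Math. 111 (1964), n° 41.  [Liu2021] Y. Liu, Camb. J. Math. 9 (2021), proof of Prop. 4.13 (l. 2145), App. D Lem. D.2.
* Tree: ★ `HodgeCM/Model/AdelicThetaDistribution` (`dist`, `dist_mem_weightForms`, `dist_ωf_V`, `dist_ωf_W`), ★ `…Sat_1` (`dist_mem_adelicThetaSpanSat`,
  `isHolGerm_dist`, `satG`), ★ `…AdelicThetaModuleFin_1` (`apply_mul_eq_self_of_mem_adelicThetaSpanSat`), ★ `…ArchKTypeOf` (`satLevelRegimeOf_le_archFinOf`),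
  ★ `Theorems/H413CuspCotComponents` (`cuspCotSat.mem_of`), ★ `Theorems/H413HolCotFormsOfModel` (`funLeft_latticeEquiv_mem_holCotForms`, `_rightShift`),
  ★ `Theorems/H413ThetaDistAtLine` (`sideAt`, `distDatumAt`).
-/

set_option autoImplicit false
set_option linter.dupNamespace false

noncomputable section

open MulAction NumberField NumberField.mixedEmbedding IsDedekindDomain
open scoped SchwartzMap TensorProduct Classical
open Literature.NumberTheory.Automorphic Literature.NumberTheory.Automorphic.UnitaryGroup Literature.NumberTheory.Weil1964
open Literature.Geometry.ComplexHyperbolic.BallModel (U21 x₀)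
open Literature.AlgebraicGeometry.ShimuraVarieties
open Literature.AlgebraicGeometry.Motives (CMType)
open Literature.NumberTheory.GelbartRogawski1991 Literature.NumberTheory.GelbartRogawski1991.UnitaryDualPair
open HodgeCM HodgeCM.Adelic HodgeCM.PerL34 HodgeCM.Model HodgeCM.Model.ThetaSpace HodgeCM.Model.ArchSideTerm HodgeCM.Model.ThetaAdelicSide
open HodgeCM.Model.SupplyResidual.WeilPairData (charInv)
open Summit.HodgeConjecture.HodgeConjecture.Cruxes.H413.CohFormsCarriers
open Summit.HodgeConjecture.HodgeConjecture.Cruxes.H413.CuspCot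

namespace Summit.HodgeConjecture.HodgeConjecture.Cruxes.H413.ThetaJunction

variable (F : HodgeCM.CMField) {ι₁ : F →+* ℂ} (V : HodgeCM.HermSpace3 F ι₁) (hV : IsAnisotropic F (HodgeCM.HermSpace3.Hm V))

/-! ## §1 The model's theta distribution is a saturated cuspidal cotangent form on the regime model -/

section Generic

variable {c : SeesawCtx F} {S : ThetaAdelicSide V c} {k : Fin 4} (D : S.ThetaDistDatum hV k)
  (hι : S.ιinf = archInfOf V) (hΓ : (S.P k).ΓU = (V.latticeModel printFact_unitaryCompact_holds).Γ)
  {K : Subgroup ↥(HodgeCM.HermSpace3.adelicFin V)} (hK : ThetaDistDatum.satG hV K ≤ S.Gfin)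
  (hLF : (S.P k).IsLFAction)
  (hd : ∀ (T : 𝓢((Fin 3 → mixedSpace (↥(maximalRealSubfield F))), ℂ) →L[ℂ] ℂ) (ℓ : Module.Dual ℂ (Fin 2 → ℂ)),
    DifferentiableAt ℝ (fun b => T (D.ωA (BallForms.expP b) (D.Φarch ℓ))) 0)
  (hCR : ∀ (T : 𝓢((Fin 3 → mixedSpace (↥(maximalRealSubfield F))), ℂ) →L[ℂ] ℂ) (ℓ : Module.Dual ℂ (Fin 2 → ℂ)) (v : Fin 2 → ℂ),
    fderiv ℝ (fun b => T (D.ωA (BallForms.expP b) (D.Φarch ℓ))) 0 (Complex.I • v) =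
      Complex.I • fderiv ℝ (fun b => T (D.ωA (BallForms.expP b) (D.Φarch ℓ))) 0 v)
  (f : C(↥(Literature.NumberTheory.Automorphic.relNormOneIdeles (↥(maximalRealSubfield F)) F) ⧸
      Literature.NumberTheory.Automorphic.relNormOneRat (↥(maximalRealSubfield F)) F, ℂ))
  {Φf : FinSB (↥(maximalRealSubfield F)) (Fin 3)} (hΦ : ∀ g ∈ K, D.ωf (g, 1) Φf = Φf)

include hι hΓ hK hLF hd hCR hΦ in
/-- **`D.dist f Φ_f ∈ cuspCotSat V hV K`** for a side with `ιinf = archInfOf V`, `ΓU = Γ`, a level `K` fixing `Φ_f` with `sat(K) ≤ Gfin`, and the analytic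
inputs of `isHolGerm_dist`: (L)(W) = ★ `dist_mem_weightForms`, (R) = saturation (★ `dist_mem_adelicThetaSpanSat`), (H) = ★ `isHolGerm_dist`.
[cite: BorelJacquet1979, §4.1–§4.2] [cite: BorelWallach2000, VII 2.10] -/
theorem dist_mem_cuspCotSat : D.dist f Φf ∈ cuspCotSat V hV K := by
  have hWt := D.dist_mem_weightForms f Φf
  have hSat := D.dist_mem_adelicThetaSpanSat K hK hΦ (Set.mem_singleton f)
  have hH := D.isHolGerm_dist hLF hd hCR f Φf
  rw [hι] at hH
  refine cuspCotSat.mem_of (fun γ hγ x => hWt.1 γ (by rw [hΓ]; exact hγ) x) (fun u x => ?_)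
    (fun a ha x => apply_mul_eq_self_of_mem_adelicThetaSpanSat hSat ha x) hH
  have h2 := hWt.2 u x
  have hκ : ThetaAdelicSide.kappa₀ S u = archInfOf V u := by
    show S.ιinf u = archInfOf V u
    rw [hι]
  rw [hκ] at h2
  exact h2

/-! ## §2 … hence its transport lies in `holCotForms (archFactorOf F V)` -/

include hι hΓ hK hLF hd hCR hΦ in
/-- **VALUES IN `holCotForms 𝔞₀`**: for `K` open, `(D.dist f Φ_f) ∘ latticeEquiv ∈ holCotForms (archFactorOf F V)` (A-p17's converse bridge ★ p791747).
[cite: BorelJacquet1979, §4.1–§4.2] [cite: BorelWallach2000, VII 2.10] -/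
theorem funLeft_latticeEquiv_dist_mem_holCotForms (hKo : IsOpen (K : Set ↥(HodgeCM.HermSpace3.adelicFin V))) :
    LinearMap.funLeft ℂ (Fin 2 → ℂ) (latticeEquiv F V hV) (D.dist f Φf) ∈ holCotForms (archFactorOf F V) :=
  funLeft_latticeEquiv_mem_holCotForms hKo (dist_mem_cuspCotSat F V hV D hι hΓ hK hLF hd hCR f hΦ)

/-! ## §3 The two laws of the transported distribution on the P0 carriers -/

omit hΦ in
/-- **EQUIVARIANCE on the P0 side**: `(dist f (ωf (k_f, 1) Φ_f)) ∘ e = rightRep F V k_f ((dist f Φ_f) ∘ e)`. [cite: BorelJacquet1979, §4.2] [cite: Weil1964, Chap. III n° 41] -/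
theorem funLeft_latticeEquiv_dist_ωf_V (kf : ↥(HodgeCM.HermSpace3.adelicFin V)) (Φf : FinSB (↥(maximalRealSubfield F)) (Fin 3)) :
    LinearMap.funLeft ℂ (Fin 2 → ℂ) (latticeEquiv F V hV) (D.dist f (D.ωf (kf, 1) Φf)) =
      rightRep F V kf (LinearMap.funLeft ℂ (Fin 2 → ℂ) (latticeEquiv F V hV) (D.dist f Φf)) := by
  rw [D.dist_ωf_V f kf Φf, funLeft_latticeEquiv_rightShift]

/-- **`χ`-COVARIANCE on the P0 side**: `(dist (charInv χ) (ωf (1, u) Φ_f)) ∘ e = χ(toIdele u)⁻¹ • ((dist (charInv χ) Φ_f) ∘ e)` — the law by which the transported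
distribution descends to the `χ`-coinvariants. [cite: Weil1964, Chap. III n° 41] [cite: Liu2021, App. D §D.1 Step 3 (l. 5221)] -/
theorem funLeft_latticeEquiv_dist_ωf_W
    (χ : PontryaginDual (↥(Literature.NumberTheory.Automorphic.relNormOneIdeles (↥(maximalRealSubfield F)) F) ⧸
      Literature.NumberTheory.Automorphic.relNormOneRat (↥(maximalRealSubfield F)) F))
    (u : D.Uf) (Φf : FinSB (↥(maximalRealSubfield F)) (Fin 3)) :
    LinearMap.funLeft ℂ (Fin 2 → ℂ) (latticeEquiv F V hV) (D.dist (charInv χ) (D.ωf (1, u) Φf)) =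
      ((D.chiFin χ u : ℂˣ) : ℂ) • LinearMap.funLeft ℂ (Fin 2 → ℂ) (latticeEquiv F V hV) (D.dist (charInv χ) Φf) := by
  rw [D.dist_ωf_W χ u Φf, map_smul]

end Generic

/-! ## §4 At the degenerate seesaw context `cDiag a` (★ `Theorems/H413ThetaDistAtLine`) -/

section AtLine

open Summit.HodgeConjecture.HodgeConjecture.Cruxes.H413.ThetaDistAtLine

variable (Φ : CMType (F : Type)) (σ : (F : Type) →+* ℂ) (a : (F : Type)) (ha : IsCMField.complexConj (F : Type) a = a) (ha0 : a ≠ 0)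
variable (η : CMAdelic (F : Type) (frameD V) × CMAdelic (F : Type) (dW (cDiag Φ σ a ha ha0).D) →* ℂˣ)
  (hη : ∀ γU ∈ CMRat (F : Type) (frameD V), ∀ γ ∈ CMRat (F : Type) (dW (cDiag Φ σ a ha ha0).D), η (γU, γ) = 1)
  (hηc : Continuous fun p => ((η p : ℂˣ) : ℂ))
  (ν : CMAdelic (F : Type) (frameD V) →* ℂˣ)
  (hν : ∀ γU ∈ CMRat (F : Type) (frameD V), ν γU = 1)
  (hνc : Continuous fun v => ((ν v : ℂˣ) : ℂ))
  (A : ∀ k : Fin 4, ArchLineInput V (lineRepT V (cDiag Φ σ a ha ha0).D (compat_plane V Φ σ a ha ha0) (compat_line₀ V Φ σ a ha ha0)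
    (compat_line₁ V Φ σ a ha ha0) (compat_line₂ V Φ σ a ha ha0) (compat_line₃ V Φ σ a ha ha0) η ν k))

/-- at the side `sideAt …` of the degenerate seesaw context, `sat(K) ≤ Gfin = archFinOf V` for every finite level `K`. -/
theorem satG_le_sideAt_Gfin (K : Subgroup ↥(HodgeCM.HermSpace3.adelicFin V)) :
    ThetaDistDatum.satG hV K ≤ (sideAt V Φ σ a ha ha0 η hη hηc ν hν hνc A).Gfin :=
  satLevelRegimeOf_le_archFinOf V hV K

variable (D : (sideAt V Φ σ a ha ha0 η hη hηc ν hν hνc A).ThetaDistDatum hV 0)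
  (hLF : ((sideAt V Φ σ a ha ha0 η hη hηc ν hν hνc A).P 0).IsLFAction)
  (hd : ∀ (T : 𝓢((Fin 3 → mixedSpace (↥(maximalRealSubfield F))), ℂ) →L[ℂ] ℂ) (ℓ : Module.Dual ℂ (Fin 2 → ℂ)),
    DifferentiableAt ℝ (fun b => T (D.ωA (BallForms.expP b) (D.Φarch ℓ))) 0)
  (hCR : ∀ (T : 𝓢((Fin 3 → mixedSpace (↥(maximalRealSubfield F))), ℂ) →L[ℂ] ℂ) (ℓ : Module.Dual ℂ (Fin 2 → ℂ)) (v : Fin 2 → ℂ),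
    fderiv ℝ (fun b => T (D.ωA (BallForms.expP b) (D.Φarch ℓ))) 0 (Complex.I • v) =
      Complex.I • fderiv ℝ (fun b => T (D.ωA (BallForms.expP b) (D.Φarch ℓ))) 0 v)
  (f : C(↥(Literature.NumberTheory.Automorphic.relNormOneIdeles (↥(maximalRealSubfield F)) F) ⧸
      Literature.NumberTheory.Automorphic.relNormOneRat (↥(maximalRealSubfield F)) F, ℂ))
  {K : Subgroup ↥(HodgeCM.HermSpace3.adelicFin V)} {Φf : FinSB (↥(maximalRealSubfield F)) (Fin 3)} (hΦ : ∀ g ∈ K, D.ωf (g, 1) Φf = Φf)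

include hLF hd hCR hΦ in
/-- **any slot-`0` datum over `sideAt …` distributes into `cuspCotSat V hV K`** (the two `rfl`s and `sat(K) ≤ archFinOf V` discharged).
[cite: BorelJacquet1979, §4.1–§4.2] [cite: BorelWallach2000, VII 2.10] -/
theorem dist_mem_cuspCotSat_sideAt : D.dist f Φf ∈ cuspCotSat V hV K :=
  dist_mem_cuspCotSat F V hV D (sideAt_ιinf V Φ σ a ha ha0 η hη hηc ν hν hνc A) (sideAt_P_ΓU V Φ σ a ha ha0 η hη hηc ν hν hνc A 0)
    (satG_le_sideAt_Gfin F V hV Φ σ a ha ha0 η hη hηc ν hν hνc A K) hLF hd hCR f hΦ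

include hLF hd hCR hΦ in
/-- **… hence into `holCotForms (archFactorOf F V)` after transport** (`K` open). [cite: BorelJacquet1979, §4.1–§4.2] [cite: BorelWallach2000, VII 2.10] -/
theorem funLeft_latticeEquiv_dist_mem_holCotForms_sideAt (hKo : IsOpen (K : Set ↥(HodgeCM.HermSpace3.adelicFin V))) :
    LinearMap.funLeft ℂ (Fin 2 → ℂ) (latticeEquiv F V hV) (D.dist f Φf) ∈ holCotForms (archFactorOf F V) :=
  funLeft_latticeEquiv_mem_holCotForms hKo (dist_mem_cuspCotSat_sideAt F V hV Φ σ a ha ha0 η hη hηc ν hν hνc A D hLF hd hCR f hΦ)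

end AtLine

end Summit.HodgeConjecture.HodgeConjecture.Cruxes.H413.ThetaJunction

end
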